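import Summits.PneNP.PneNP.Theorems.SymmetryBudgetNoHiddenOrderProgramRank
import Summits.PneNP.PneNP.Theorems.SymmetryBudgetNoHiddenOrderValueGadgetsDefs

/-!
# `NoHiddenOrder` (stmt-PneNP-14781), (R2c) VI: the window canoniser program — module records, small shapes

Route `PneNP/SymmetryBudget`; continues `SymmetryBudgetNoHiddenOrderProgramRank.lean`.  The kit's gadget RECORDS over the program `prog m`,
built generically from an embedding of the shape whose kinds and sources dispatch to the shape's tables (`ccRec`, `ctRec`, `riRec`, `rvRec`,
`vsRec`, `voRec`, `vaRec`), and the two root modules: the signature comparison `sigVC` and the root refinement with value read-out `rootRV`.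
Definitions only; supports stmt-PneNP-14781.
-/

set_option linter.dupNamespace false -- `Summit.PneNP.PneNP.…` (D-0017 single-conjunct layout)

namespace Summit.PneNP.PneNP.Theorems

open Finset CGBits BranchSum Literature.Computability.Complexity Literature.Computability.Complexity.SymProg

namespace WCanon.R2c

variable {m : ℕ}

/-! ### Count comparisons -/

/-- A `CmpCount` record from an embedded shape. [folklore] -/
noncomputable def ccRec (A B : Finset (Wire m)) (e : CCGate m → Gt m) (hk : ∀ g, (prog m).kind (e g) = ccKind g)
    (hs : ∀ g, (prog m).srcs (e g) = ccSrcs A B e g) : (prog m).CmpCount (pN m) where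
  A := A
  B := B
  geA θ := e (.geA θ)
  geB θ := e (.geB θ)
  ngeA θ := e (.ngeA θ)
  both θ := e (.both θ)
  none θ := e (.none θ)
  eqv θ := e (.eqv θ)
  eq := e .eq
  ltw θ := e (.ltw θ)
  lt := e .lt
  kind_geA _ := hk _
  srcs_geA _ := hs _
  kind_geB _ := hk _
  srcs_geB _ := hs _
  kind_ngeA _ := hk _
  srcs_ngeA _ := hs _
  kind_both _ := hk _
  srcs_both _ := hs _
  kind_none _ := hk _
  srcs_none _ := hs _
  kind_eqv _ := hk _
  srcs_eqv _ := hs _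
  kind_eq := hk _
  srcs_eq := hs _
  kind_ltw _ := hk _
  srcs_ltw _ := hs _
  kind_lt := hk _
  srcs_lt := hs _

/-- A `CmpTwice` record from an embedded shape. [folklore] -/
noncomputable def ctRec (A B : Finset (Wire m)) (e : CTGate m → Gt m) (hk : ∀ g, (prog m).kind (e g) = ctKind g)
    (hs : ∀ g, (prog m).srcs (e g) = ctSrcs A B e g) : (prog m).CmpTwice (pN m) where
  A := A
  B := B
  ge2A θ := e (.ge2A θ)
  geB θ := e (.geB θ)
  nge2A θ := e (.nge2A θ)
  tww θ := e (.tww θ)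
  tw := e .tw
  kind_ge2A _ := hk _
  srcs_ge2A _ := hs _
  kind_geB _ := hk _
  srcs_geB _ := hs _
  kind_nge2A _ := hk _
  srcs_nge2A _ := hs _
  kind_tww _ := hk _
  srcs_tww _ := hs _
  kind_tw := hk _
  srcs_tw := hs _

/-! ### Refinement with value read-out -/

/-- A `RefineIter` record (`T = wn m` rounds) from an embedded refinement shape (with an injective embedding). [folklore] -/
noncomputable def riRec (ι : RIIn m) (e : RIGate m → Gt m) (he : Function.Injective e) (hk : ∀ g, (prog m).kind (e g) = riKind g)
    (hs : ∀ g, (prog m).srcs (e g) = riSrcs ι e g) : (prog m).RefineIter (WV m) (pN m) (wn m) where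
  mem := ι.mem
  adj := ι.adj
  lt0 := ι.lt0
  eq0 := ι.eq0
  c r u w y := e (.c r u w y)
  cmp r u v w :=
    ccRec (univ.image fun y => Sum.inr (e (.c r u w y))) (univ.image fun y => Sum.inr (e (.c r v w y))) (fun g => e (.cmp r u v w g))
      (fun _ => hk _) (fun _ => hs _)
  nmem w := e (.nmem w)
  nlt r w' w := e (.nlt r w' w)
  pre r u v w w' := e (.pre r u v w w')
  allpre r u v w := e (.allpre r u v w)
  wit r u v w := e (.wit r u v w)
  prof r u v := e (.prof r u v)
  tie r u v := e (.tie r u v)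
  ltS r u v := e (.ltS r u v)
  eqS r u v := e (.eqS r u v)
  c_injective r u w y y' h := by simpa using he h
  kind_c _ _ _ _ := hk _
  srcs_c _ _ _ _ := hs _
  cmp_A _ _ _ _ := rfl
  cmp_B _ _ _ _ := rfl
  kind_nmem _ := hk _
  srcs_nmem _ := hs _
  kind_nlt _ _ _ := hk _
  srcs_nlt _ _ _ := hs _
  kind_pre _ _ _ _ _ := hk _
  srcs_pre _ _ _ _ _ := hs _
  kind_allpre _ _ _ _ := hk _
  srcs_allpre _ _ _ _ := hs _
  kind_wit _ _ _ _ := hk _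
  srcs_wit _ _ _ _ := hs _
  kind_prof _ _ _ := hk _
  srcs_prof _ _ _ := hs _
  kind_tie _ _ _ := hk _
  srcs_tie _ _ _ := hs _
  kind_ltS _ _ _ := hk _
  srcs_ltS _ _ _ := hs _
  kind_eqS _ _ _ := hk _
  srcs_eqS _ _ _ := hs _

/-- A `RefVal` record (values `< wn m`) from an embedded refinement shape. [folklore] -/
noncomputable def rvRec (ι : RIIn m) (e : RIGate m → Gt m) (he : Function.Injective e) (hk : ∀ g, (prog m).kind (e g) = riKind g)
    (hs : ∀ g, (prog m).srcs (e g) = riSrcs ι e g) : RefVal (prog m) (WV m) (pN m) (wn m) (wn m) where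
  RI := riRec ι e he hk hs
  c w v := e (.vc w v)
  ge v t := e (.vge v t)
  nge v t := e (.vnge v t)
  inA v t := e (.vinA v t)
  nm v := e (.vnm v)
  val v t := e (.vval v t)
  c_injective v w w' h := by simpa using he h
  kind_c _ _ := hk _
  srcs_c _ _ := hs _
  kind_ge _ _ := hk _
  srcs_ge _ _ := hs _
  kind_nge _ _ := hk _
  srcs_nge _ _ := hs _
  kind_inA _ _ := hk _
  srcs_inA _ _ := hs _
  kind_nm _ := hk _
  srcs_nm _ := hs _
  kind_val _ _ := hk _
  srcs_val _ _ := hs _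

/-! ### Vector comparisons -/

/-- The signature `VecCmp` record from an embedded shape. [folklore] -/
noncomputable def vsRec (b : WV m → Fin (m + m) → Wire m) (e : VSGate m → Gt m) (hk : ∀ g, (prog m).kind (e g) = vsKind g)
    (hs : ∀ g, (prog m).srcs (e g) = vsSrcs b e g) : (prog m).VecCmp (WV m) (m + m) where
  b := b
  both k k' j := e (.both k k' j)
  none k k' j := e (.none k k' j)
  eqv k k' j := e (.eqv k k' j)
  nb k j := e (.nb k j)
  lt k k' j := e (.lt k k' j)
  less k k' := e (.less k k')
  eqall k k' := e (.eqall k k')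
  kind_both _ _ _ := hk _
  srcs_both _ _ _ := hs _
  kind_none _ _ _ := hk _
  srcs_none _ _ _ := hs _
  kind_eqv _ _ _ := hk _
  srcs_eqv _ _ _ := hs _
  kind_nb _ _ := hk _
  srcs_nb _ _ := hs _
  kind_lt _ _ _ := hk _
  srcs_lt _ _ _ := hs _
  kind_less _ _ := hk _
  srcs_less _ _ := hs _
  kind_eqall _ _ := hk _
  srcs_eqall _ _ := hs _

/-- The candidates' `VecCmp` record from an embedded shape. [folklore] -/
noncomputable def voRec (b : WV m × Fin (wn m) → Fin (NB (wn m)) → Wire m) (e : VOGate m → Gt m)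
    (hk : ∀ g, (prog m).kind (e g) = voKind g) (hs : ∀ g, (prog m).srcs (e g) = voSrcs b e g) :
    (prog m).VecCmp (WV m × Fin (wn m)) (NB (wn m)) where
  b := b
  both k k' j := e (.both k k' j)
  none k k' j := e (.none k k' j)
  eqv k k' j := e (.eqv k k' j)
  nb k j := e (.nb k j)
  lt k k' j := e (.lt k k' j)
  less k k' := e (.less k k')
  eqall k k' := e (.eqall k k')
  kind_both _ _ _ := hk _
  srcs_both _ _ _ := hs _
  kind_none _ _ _ := hk _
  srcs_none _ _ _ := hs _
  kind_eqv _ _ _ := hk _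
  srcs_eqv _ _ _ := hs _
  kind_nb _ _ := hk _
  srcs_nb _ _ := hs _
  kind_lt _ _ _ := hk _
  srcs_lt _ _ _ := hs _
  kind_less _ _ := hk _
  srcs_less _ _ := hs _
  kind_eqall _ _ := hk _
  srcs_eqall _ _ := hs _

/-- The parts' `VecCmp` record from an embedded shape. [folklore] -/
noncomputable def vaRec (b : Finset (WV m) → Fin (NB (wn m)) → Wire m) (e : VAGate m → Gt m)
    (hk : ∀ g, (prog m).kind (e g) = vaKind g) (hs : ∀ g, (prog m).srcs (e g) = vaSrcs b e g) :
    (prog m).VecCmp (Finset (WV m)) (NB (wn m)) where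
  b := b
  both k k' j := e (.both k k' j)
  none k k' j := e (.none k k' j)
  eqv k k' j := e (.eqv k k' j)
  nb k j := e (.nb k j)
  lt k k' j := e (.lt k k' j)
  less k k' := e (.less k k')
  eqall k k' := e (.eqall k k')
  kind_both _ _ _ := hk _
  srcs_both _ _ _ := hs _
  kind_none _ _ _ := hk _
  srcs_none _ _ _ := hs _
  kind_eqv _ _ _ := hk _
  srcs_eqv _ _ _ := hs _
  kind_nb _ _ := hk _
  srcs_nb _ _ := hs _
  kind_lt _ _ _ := hk _
  srcs_lt _ _ _ := hs _
  kind_less _ _ := hk _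
  srcs_less _ _ := hs _
  kind_eqall _ _ := hk _
  srcs_eqall _ _ := hs _

/-! ### The root modules -/

variable (m)

/-- **The signature comparison at the root.** [folklore] -/
noncomputable def sigVC : (prog m).VecCmp (WV m) (m + m) := vsRec sigW .sig (fun _ => rfl) (fun _ => rfl)

/-- **The root refinement of the signature colouring over the whole window, with value read-out.** [folklore] -/
noncomputable def rootRV : RefVal (prog m) (WV m) (pN m) (wn m) (wn m) :=
  rvRec (rootIn m) .root (fun _ _ h => Gt.root.inj h) (fun _ => rfl) (fun _ => rfl)

end WCanon.R2c

end Summit.PneNP.PneNP.Theorems
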